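import Summits.KontsevichZagierPeriods.KontsevichZagierPeriods.Theses.HurwitzMicroSectors
import Literature.NumberTheory.Transcendental.PeriodsWave0
import Literature.NumberTheory.Transcendental.PeriodsWave0Proofs
import Literature.NumberTheory.Transcendental.PeriodsWave0ZudilinProofs
import Literature.Barriers.KontsevichZagierPeriods.GrothendieckPeriodConjectureDependenceOddZetaProofs

/-!
# Sketch (ideator 3, crux stmt-KontsevichZagierPeriods-14341 `HurwitzSectorComplement`) — first lemmas

Typed first lemmas of the two crux idea cards of this seat; nothing here is a route item.

§A  `chebyshev-parity-ladder` — the parity (reflection) relations of Hurwitz values inside the rules: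
    the double-angle change of variables (ONE `changeOfVariablesRel` instance), the two Stokes steps
    with RATIONAL primitives, the cosine-square chain `C₂(θ) + η(2) = (π − θ)²/4`, Euler's chain
    `6ζ(2) ∼ π ⊗ π`, and the unconditional Euler–parity sector statement in weight 2, level `N`.
§B  `pade-column-theorems` — the height axis `P(t)/(q − t)` (rigidity = irrationality of
    `Li_w(1/q)`, Padé school) and the level-`1`/`2` columns (rigidity = irrationality of `ζ(w)`):
    infinitely many odd-weight rungs (Ball–Rivoal) and one of the rungs `5,7,9,11` (Zudilin) are
    derived HERE from the column statement and the tree's PROVED facts.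
-/

noncomputable section

set_option linter.dupNamespace false

open MeasureTheory Set Polynomial
open Literature.NumberTheory.Transcendental

namespace Summit.KontsevichZagierPeriods.KontsevichZagierPeriods.Cruxes.HurwitzSectorComplement.SketchIdeator3

/-- The open unit box `(0,1)ⁿ`. -/
def box (n : ℕ) : Set (Fin n → ℝ) := {x | ∀ i, x i ∈ Ioo (0:ℝ) 1}

/-! ## §A — parity inside the rules -/

/-- **The double-angle move (load-bearing new move of card A).** For `-1 < c ≤ 1`, the RATIONAL map
`Φ(t,u) = (u, V(t,u))`, `V(t,u) = (t² + 2ut − 1 − 2u²t²)/(1 − 2ut + t²)` (`= sin(2·arctan((t−u)/√(1−u²)) + 2·arctan(u/√(1−u²)) − π/2)`,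
`V(0,u) = −1`, `V(1,u) = u`, `∂ₜV = 4t(1−ut)(1−u²)/(1−2ut+t²)² > 0`) carries the Chebyshev-`U` kernel
`1/(1 − 2ut + t²)` on `(0,1) × (−1,c)` to `1/(2√(1−u²)√(1−v²))` on `{−1 < v < u < c}`:
`[r] − [r']` is ONE change-of-variables move (kit job j011850: Jacobian identity checked symbolically). -/
def DoubleAngleMove : Prop :=
  ∀ (c : ℝ), -1 < c → c ≤ 1 →
  ∀ (r r' : KZ.IntegralRep 2),
    r.domain = {x | x 0 ∈ Ioo (0:ℝ) 1 ∧ x 1 ∈ Ioo (-1:ℝ) c} →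
    (∀ x ∈ r.domain, r.integrand x = 1 / (1 - 2 * x 1 * x 0 + x 0 ^ 2)) →
    r'.domain = {y | y 0 ∈ Ioo (-1:ℝ) c ∧ y 1 ∈ Ioo (-1:ℝ) (y 0)} →
    (∀ y ∈ r'.domain, r'.integrand y = 1 / (2 * Real.sqrt (1 - y 0 ^ 2) * Real.sqrt (1 - y 1 ^ 2))) →
    KZ.of r - KZ.of r' ∈ KZ.changeOfVariablesRel

/-- **Stokes in the cosine parameter (rule 3, primitive = the kernel itself).** With
`g(τ,u) = (u − τ)/(1 − 2uτ + τ²)` (`= Re ζ/(1−ζτ)`, `u = Re ζ`) and `∂ᵤg = (1 − τ²)/(1−2uτ+τ²)²`: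
the 3-dimensional representation of `∂ᵤg(x₀x₁, u)` on the band `(0,1)² × [−1,c]` minus the
2-dimensional one of `g(x₀x₁,c) − g(x₀x₁,−1) = g(x₀x₁,c) + 1/(1 + x₀x₁)` on the box is ONE
Newton–Leibniz move. -/
def CosineParameterStokes : Prop :=
  ∀ (c : ℝ), -1 ≤ c → c ≤ 1 →
  ∀ (r : KZ.IntegralRep 3) (r' : KZ.IntegralRep 2),
    r'.domain = box 2 →
    r.domain = {z | (Fin.init z : Fin 2 → ℝ) ∈ box 2 ∧ -1 ≤ z (Fin.last 2) ∧ z (Fin.last 2) ≤ c} →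
    (∀ z ∈ r.domain, r.integrand z =
        (1 - (z 0 * z 1) ^ 2) / (1 - 2 * z 2 * (z 0 * z 1) + (z 0 * z 1) ^ 2) ^ 2) →
    (∀ x ∈ r'.domain, r'.integrand x =
        (c - x 0 * x 1) / (1 - 2 * c * (x 0 * x 1) + (x 0 * x 1) ^ 2) + 1 / (1 + x 0 * x 1)) →
    KZ.of r - KZ.of r' ∈ KZ.newtonLeibnizRel

/-- **Stokes in the last box variable (rule 3, RATIONAL primitive `s/(1 − 2u·st + s²t²)`).**
Coordinates `(t, u, s)`: the 3-dimensional representation of `(1 − s²t²)/(1 − 2u·st + s²t²)²` on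
`{(t,u,s) | t ∈ (0,1), u ∈ (−1,c), 0 ≤ s ≤ 1}` minus the 2-dimensional Chebyshev-`U` kernel
`1/(1 − 2ut + t²)` on `(0,1) × (−1,c)` is ONE Newton–Leibniz move
(`∂ₛ[s/(1−2ust+s²t²)] = (1−s²t²)/(1−2ust+s²t²)²`, checked symbolically, j011850). -/
def LastVariableStokes : Prop :=
  ∀ (c : ℝ), -1 < c → c ≤ 1 →
  ∀ (r : KZ.IntegralRep 3) (r' : KZ.IntegralRep 2),
    r'.domain = {x | x 0 ∈ Ioo (0:ℝ) 1 ∧ x 1 ∈ Ioo (-1:ℝ) c} →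
    r.domain = {z | (Fin.init z : Fin 2 → ℝ) ∈ r'.domain ∧ 0 ≤ z (Fin.last 2) ∧ z (Fin.last 2) ≤ 1} →
    (∀ z ∈ r.domain, r.integrand z =
        (1 - (z 2 * z 0) ^ 2) / (1 - 2 * z 1 * (z 2 * z 0) + (z 2 * z 0) ^ 2) ^ 2) →
    (∀ x ∈ r'.domain, r'.integrand x = 1 / (1 - 2 * x 1 * x 0 + x 0 ^ 2)) →
    KZ.of r - KZ.of r' ∈ KZ.newtonLeibnizRel

/-- **The cosine-square chain** `C₂(θ) + η(2) = (π − θ)²/4` **inside the rules** (`c = cos θ`):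
`[box, g(τ,c) + 1/(1+τ)] ∼ [(−1,c)², 1/(4√(1−u²)√(1−v²))]` — composition of the three moves above,
a coordinate permutation, two null-face adjustments and a symmetrisation (~10 primitive moves).
At `c = cos(2πj/N)` the right-hand side is `(π(N−2j)/N)²/4`, a product of two arcs. -/
def CosineSquareChain : Prop :=
  ∀ (c : ℝ), -1 < c → c ≤ 1 →
  ∀ (r r' : KZ.IntegralRep 2),
    r.domain = box 2 →
    EqOn r.integrand
      (fun x => (c - x 0 * x 1) / (1 - 2 * c * (x 0 * x 1) + (x 0 * x 1) ^ 2) + 1 / (1 + x 0 * x 1))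
      r.domain →
    r'.domain = {y | y 0 ∈ Ioo (-1:ℝ) c ∧ y 1 ∈ Ioo (-1:ℝ) c} →
    EqOn r'.integrand (fun y => 1 / (4 * Real.sqrt (1 - y 0 ^ 2) * Real.sqrt (1 - y 1 ^ 2)))
      r'.domain →
    KZ.Equivalent r r'

/-- **Euler's identity as a chain** (the case `c = 1`: `g(τ,1) = 1/(1−τ)`):
`[box, 2/(1 − x²y²)] ∼ [(−1,1)², 1/(4√(1−u²)√(1−v²))]`, i.e. `(3/2)ζ(2) = π²/4`,
i.e. `6ζ(2) = π ⊗ π` with `π ⊗ π := [(−1,1)², 1/(√(1−u²)√(1−v²))]`. -/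
def EulerChainZetaTwo : Prop :=
  ∀ (r r' : KZ.IntegralRep 2),
    r.domain = box 2 →
    EqOn r.integrand (fun x => 2 / (1 - (x 0 * x 1) ^ 2)) r.domain →
    r'.domain = {y | y 0 ∈ Ioo (-1:ℝ) 1 ∧ y 1 ∈ Ioo (-1:ℝ) 1} →
    EqOn r'.integrand (fun y => 1 / (4 * Real.sqrt (1 - y 0 ^ 2) * Real.sqrt (1 - y 1 ^ 2)))
      r'.domain →
    KZ.Equivalent r r'

/-- **Chebyshev arc moves (the circle's dilations).** For `0 < 2j < N`, `c = cos(2πj/N)`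
(entered as `Polynomial.Chebyshev.T ℝ N` evaluated: `T_N(c) = 1`, and `c` the `j`-th largest such root —
here we only need SOME real `c` with the stated arc length), `N·arc(c) = (N − 2j)·arc(1)` as
one-dimensional representations: `[(−1,c), N/√(1−u²)] ∼ [(−1,1), (N−2j)/√(1−u²)]`, by `N − 2j`
change-of-variables moves `u ↦ ±T_N(−u)`-type on the pieces `(−cos(kπ/N), −cos((k+1)π/N))` plus
additivity. Typed with the arc length as the hypothesis on `c`. -/
def ChebyshevArcMove : Prop :=
  ∀ (N j : ℕ) (c : ℝ), 0 < j → 2 * j < N → Real.arccos (-c) = Real.pi * (N - 2 * j) / N →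
  ∀ (r r' : KZ.IntegralRep 1),
    r.domain = {x | x 0 ∈ Ioo (-1:ℝ) c} →
    EqOn r.integrand (fun x => (N : ℝ) / Real.sqrt (1 - x 0 ^ 2)) r.domain →
    r'.domain = {x | x 0 ∈ Ioo (-1:ℝ) 1} →
    EqOn r'.integrand (fun x => ((N : ℝ) - 2 * j) / Real.sqrt (1 - x 0 ^ 2)) r'.domain →
    KZ.Equivalent r r'

/-- **Euler–parity sector, weight 2, level `N` — COMPLETE, UNCONDITIONALLY (card A's first rung
family).** Representations on the open box `(0,1)²` whose integrand is a reflection-symmetric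
element of the level-`N` sector, `Σ_{k ≤ N−2} p_k (t^k + t^{N−2−k})/(1 − t^N) + p_∞ t^{N−1}/(1−t^N) + Q(t)`
(`t = x₀x₁`, `p ∈ ℚ^ℕ`, `Q ∈ ℚ[t]`): values lie in `ℚ + π²·ℚ(ζ_N)⁺`; equal values ⇒ KZ-equivalent.
Reduction = partial fractions over `ℚ(ζ_N)⁺` + `CosineSquareChain` + `ChebyshevArcMove` + Euler;
rigidity = Lindemann (`transcendental_pi_holds`) only. -/
def EulerParitySectorTwo (N : ℕ) : Prop :=
  ∀ (r r' : KZ.IntegralRep 2) (p p' : ℕ → ℚ) (q q' : ℚ) (Q Q' : Polynomial ℚ),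
    r.domain = box 2 → r'.domain = box 2 →
    EqOn r.integrand (fun x =>
      ((∑ k ∈ Finset.range (N - 1), (p k : ℝ) * ((x 0 * x 1) ^ k + (x 0 * x 1) ^ (N - 2 - k)))
          + (q : ℝ) * (x 0 * x 1) ^ (N - 1)) / (1 - (x 0 * x 1) ^ N)
        + Polynomial.aeval (x 0 * x 1) Q) r.domain →
    EqOn r'.integrand (fun x =>
      ((∑ k ∈ Finset.range (N - 1), (p' k : ℝ) * ((x 0 * x 1) ^ k + (x 0 * x 1) ^ (N - 2 - k)))
          + (q' : ℝ) * (x 0 * x 1) ^ (N - 1)) / (1 - (x 0 * x 1) ^ N)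
        + Polynomial.aeval (x 0 * x 1) Q') r'.domain →
    r.value = r'.value → KZ.Equivalent r r'

/-! ## §B — the Padé columns -/

/-- The box sector `(w, N)` of the route, any weight `w ≥ 2` and level `N ≥ 1`: Conjecture 1 for
pairs of representations on `(0,1)ʷ` with integrands `P(t)/(1 − t^N)`, `t = x₀⋯x_{w−1}`. -/
def SectorComplete (w N : ℕ) : Prop :=
  ∀ (r r' : KZ.IntegralRep w) (P P' : Polynomial ℚ),
    r.domain = box w → r'.domain = box w →
    EqOn r.integrand (fun x => Polynomial.aeval (∏ i, x i) P / (1 - (∏ i, x i) ^ N)) r.domain →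
    EqOn r'.integrand (fun x => Polynomial.aeval (∏ i, x i) P' / (1 - (∏ i, x i) ^ N)) r'.domain →
    r.value = r'.value → KZ.Equivalent r r'

/-- **The height-axis sector `(w; q)`** (card B): Conjecture 1 for pairs of representations on
`(0,1)ʷ` with integrands `P(t)/(q − t)`, `q ∈ ℤ` (values in `ℚ + ℚ·Li_w(1/q)`; `q = 1` is the
route's level `1`, `q = −1` the alternating level-`2` class, `|q| ≥ 2` the polylogarithm values at `1/q`). -/
def PadeSectorComplete (w : ℕ) (q : ℤ) : Prop :=
  ∀ (r r' : KZ.IntegralRep w) (P P' : Polynomial ℚ),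
    r.domain = box w → r'.domain = box w →
    EqOn r.integrand (fun x => Polynomial.aeval (∏ i, x i) P / ((q : ℝ) - ∏ i, x i)) r.domain →
    EqOn r'.integrand (fun x => Polynomial.aeval (∏ i, x i) P' / ((q : ℝ) - ∏ i, x i)) r'.domain →
    r.value = r'.value → KZ.Equivalent r r'

/-- `Li_w(1/q) = Σ_{n ≥ 0} 1/(q^{n+1}(n+1)ʷ)` as a real series (the value of `[boxʷ, 1/(q − t)]`). -/
def polylogInv (w : ℕ) (q : ℤ) : ℝ := ∑' n : ℕ, 1 / ((q : ℝ) ^ (n + 1) * ((n : ℝ) + 1) ^ w)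

/-- **Height column (card B, first lemma).** In every weight `w ≥ 2` and for every integer `q`,
irrationality of `Li_w(1/q)` implies Conjecture 1 on the sector `(w; q)`: reduction is division with
remainder `P(t) = (P(t) − P(q)) + P(q)` (NO distribution relation) plus the route's polynomial-part
engine; rigidity compares the coefficients of `a + b·Li_w(1/q)`. The hypothesis is a THEOREM for
`|q| ≥ q₀(w)` (Nikishin 1979; `w = 2`: Hata 1990 / Rhin–Viola 2005; several `q`'s and weights at once:
Marcovecchio 2006, David–Hirata-Kohno–Kawashima 2020–23). -/
def HeightColumn : Prop :=
  ∀ (w : ℕ), 2 ≤ w → ∀ (q : ℤ), Irrational (polylogInv w q) → PadeSectorComplete w q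

/-- **Level-one/level-two columns (card B, second lemma).** In every weight `w ≥ 2`,
irrationality of `ζ(w)` implies Conjecture 1 on the sectors `(w,1)` and `(w,2)` (level `2` needs ONE
`m = 2` dilation: `h₀ + h₁ ∼ 2ʷ h₁`; this is `AperySectorThreeTwo`'s proof with `3 ↦ w`). -/
def LevelLeTwoColumns : Prop :=
  ∀ (w : ℕ), 2 ≤ w → Irrational (zetaValue w) → SectorComplete w 1 ∧ SectorComplete w 2

/-- **Infinitely many odd-weight rungs close unconditionally** — from the column statement and the
tree's PROVED `infinite_setOf_irrational_zetaValue_odd_holds` (Ball–Rivoal). -/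
theorem infinite_oddWeight_levelOne (h : LevelLeTwoColumns) :
    {k : ℕ | SectorComplete (2 * k + 1) 1}.Infinite := by
  refine Set.Infinite.mono ?_
    ((infinite_setOf_irrational_zetaValue_odd_holds).sdiff (Set.finite_singleton 0))
  intro k hk
  simp only [mem_sdiff, mem_setOf_eq, mem_singleton_iff] at hk
  have hk2 : 2 ≤ 2 * k + 1 := by omega
  exact (h (2 * k + 1) hk2 hk.1).1

/-- **One of the rungs `(5,1), (7,1), (9,1), (11,1)` closes unconditionally** — from the column
statement and the tree's PROVED `zudilin_holds`. -/
theorem zudilin_rung (h : LevelLeTwoColumns) :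
    SectorComplete 5 1 ∨ SectorComplete 7 1 ∨ SectorComplete 9 1 ∨ SectorComplete 11 1 := by
  rcases zudilin_holds with h5 | h7 | h9 | h11
  · exact Or.inl (h 5 (by norm_num) h5).1
  · exact Or.inr (Or.inl (h 7 (by norm_num) h7).1)
  · exact Or.inr (Or.inr (Or.inl (h 9 (by norm_num) h9).1))
  · exact Or.inr (Or.inr (Or.inr (h 11 (by norm_num) h11).1))

/-- **The weight-3 rung is the route's proved crux antecedent in this typing** (pattern check:
`SectorComplete 3 2` has the shape of `AperySectorThreeTwo` with `∏ i, x i` for `x 0 * x 1 * x 2`). -/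
theorem levelTwo_weightThree_of_columns (h : LevelLeTwoColumns) : SectorComplete 3 2 :=
  (h 3 (by norm_num) irrational_zetaValue_three_holds).2

/-- **Every even-weight rung of levels `1` and `2` closes unconditionally** — from the column
statement, Euler and Lindemann (tree: `Literature.Barriers.KontsevichZagierPeriods.transcendental_zetaValue_two_mul`,
PROVED from `transcendental_pi_holds`). -/
theorem evenWeight_levelLeTwo (h : LevelLeTwoColumns) {k : ℕ} (hk : k ≠ 0) :
    SectorComplete (2 * k) 1 ∧ SectorComplete (2 * k) 2 :=
  h (2 * k) (by omega)
    (Literature.Barriers.KontsevichZagierPeriods.transcendental_zetaValue_two_mul hk).irrational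

/-- **The level-one column is co-finite in no known sense, but it is complete on a set of weights of
full lower density ≥ 1/2 plus an infinite odd set**: packaging of the three corollaries. -/
theorem levelOne_complete_weights (h : LevelLeTwoColumns) :
    (∀ k : ℕ, k ≠ 0 → SectorComplete (2 * k) 1) ∧ {k : ℕ | SectorComplete (2 * k + 1) 1}.Infinite ∧
      (SectorComplete 5 1 ∨ SectorComplete 7 1 ∨ SectorComplete 9 1 ∨ SectorComplete 11 1) :=
  ⟨fun _ hk => (evenWeight_levelLeTwo h hk).1, infinite_oddWeight_levelOne h, zudilin_rung h⟩

end Summit.KontsevichZagierPeriods.KontsevichZagierPeriods.Cruxes.HurwitzSectorComplement.SketchIdeator3
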